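import Mathlib
import Literature.NumberTheory.Automorphic.TunnellOctahedralGlobal
import Literature.NumberTheory.Automorphic.AutomorphicRepsGLSatakeFlathProofs

/-!
# Icosahedral descent (crux `IcosahedralDescentLevel`, line `Sketch`) — Case B of the fibre theorem

Uniform quadratic descent for an Artin representation over `ℚ`, the "Case B" bookkeeping step.
`π` is cuspidal on `GL₂(𝔸_ℚ)` and `Q = BC_K(π)` is a weak (almost-everywhere) base change lift of
`π` to the quadratic field `K` (`IsWeakBaseChangeLiftAE π Q`: at almost every place `u` of `K`,
for `v` below `u` and `α = t_{π,v}`, `t_{Q,u} = α^{f(u|v)}`).  In Case B of Arthur–Clozel's fibre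
theorem (Ch. 3, Thm. 3.1) the cuspidal `P` on `GL₂(𝔸_K)` has Satake parameters
`ε_{L/K}(u) · t_{Q,u}` almost everywhere; the splitting law gives
`ε_{L/K}(u) = ε_{K₁/ℚ}(v)^{f(u|v)}` almost everywhere; and the twist `π♭ = π ⊗ η_{K₁/ℚ}` has
Satake parameters `ε_{K₁/ℚ}(v) · t_{π,v}` almost everywhere.  Then `P` is a weak base change lift
of `π♭`, because `(ε(v) a)^f = ε(v)^f a^f = ε_{L/K}(u) a^f`.  The proof is pure filter / multiset
bookkeeping on the model of `IsWeakBaseChangeLiftAE.of_twist_quadraticSign`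
(`Automorphic/TunnellOctahedralGlobal`), with the uniqueness and almost-everywhere existence of
Satake parameters supplied by the proved facts `AutomorphicRepData.hasSatakeParamAt_unique_holds`,
`AutomorphicRepData.hasSatakeParamAt_cofinite_holds` (`AutomorphicRepsGLSatakeFlathProofs`).
-/

-- `Summit.Langlands.Langlands.…`: the repeated path component is the tree's layout (D-0017).
set_option linter.dupNamespace false

noncomputable section

open scoped MatrixGroups NumberField Polynomial Classical
open NumberField IsDedekindDomain Field Filter
open Literature.NumberTheory.Automorphic Literature.NumberTheory.GaloisRepresentations

namespace Summit.Langlands.Langlands.Theorems.IcosahedralDescentLevel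

/-- **Case B of the fibre theorem transfers the weak lift to the twist.**  If `Q` is a weak base
change lift of `π` to `K`, `P` has Satake parameters `ε_{L/K}(u) · t_{Q,u}` almost everywhere,
the splitting law `ε_{L/K}(u) = ε_{K₁/ℚ}(v)^{f(u|v)}` holds almost everywhere, and `π♭` has Satake
parameters `ε_{K₁/ℚ}(v) · t_{π,v}` almost everywhere, then `P` is a weak base change lift of `π♭`:
at a good place `u` over `v`, a Satake parameter `α♭` of `π♭` at `v` is `ε_{K₁/ℚ}(v) · α` for the
Satake parameter `α` of `π` at `v` (existence almost everywhere and uniqueness of Satake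
parameters), `t_{Q,u} = α^{f(u|v)}`, `t_{P,u} = ε_{L/K}(u) · α^{f(u|v)}`, and
`(ε_{K₁/ℚ}(v) a)^f = ε_{K₁/ℚ}(v)^f a^f = ε_{L/K}(u) a^f`. [folklore] -/
theorem isWeakBaseChangeLiftAE_twist_of_caseB (K₁ : Type) [Field K₁] [NumberField K₁] (K : Type) [Field K] [NumberField K]
    (L : Type) [Field L] [NumberField L] [Algebra K L]
    (hQ : isCompact_glFiniteIntegralLevel 2 ℚ) (hK : isCompact_glFiniteIntegralLevel 2 K)
    (π πf : CuspidalAutomorphicRepData 2 ℚ hQ) (Q P : CuspidalAutomorphicRepData 2 K hK)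
    (hlift : IsWeakBaseChangeLiftAE π.1 Q.1)
    (hB : ∀ᶠ u : HeightOneSpectrum (𝓞 K) in cofinite, ∀ α : Multiset ℂ,
      Q.1.HasSatakeParamAt u α → P.1.HasSatakeParamAt u (α.map (quadraticSign L u * ·)))
    (hsplit : ∀ᶠ u : HeightOneSpectrum (𝓞 K) in cofinite, ∀ v : HeightOneSpectrum (𝓞 ℚ),
      u.asIdeal.under (𝓞 ℚ) = v.asIdeal →
        quadraticSign L u = quadraticSign K₁ v ^ u.asIdeal.inertiaDeg (𝓞 ℚ))
    (htw : ∀ᶠ v : HeightOneSpectrum (𝓞 ℚ) in cofinite, ∀ α : Multiset ℂ,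
      π.1.HasSatakeParamAt v α → πf.1.HasSatakeParamAt v (α.map (quadraticSign K₁ v * ·))) :
    IsWeakBaseChangeLiftAE πf.1 P.1 := by
  -- Satake parameters of `π` exist almost everywhere; those of `π♭` are unique
  have hSC : π.1.hasSatakeParamAt_cofinite := AutomorphicRepData.hasSatakeParamAt_cofinite_holds π.1
  have hSU : πf.1.hasSatakeParamAt_unique := AutomorphicRepData.hasSatakeParamAt_unique_holds πf.1
  -- pull the `v`-indexed almost-everywhere statements up to the places `u` of `K`
  have A := eventually_under (E := K) (hSC.and htw)
  refine ((hlift.and hB).and (hsplit.and A)).mono fun u ⟨⟨hu0, huB⟩, husplit, huA⟩ v α₁ hv hα₁ => ?_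
  obtain ⟨⟨α₀, hα₀⟩, htwv⟩ := huA v hv
  -- `α₁ = ε_{K₁/ℚ}(v) · α₀` by uniqueness of the Satake parameter of `π♭` at `v`
  have heq : α₁ = α₀.map (quadraticSign K₁ v * ·) := hSU hα₁ (htwv α₀ hα₀)
  -- `t_{P,u} = ε_{L/K}(u) · α₀^{f(u|v)} = ε_{K₁/ℚ}(v)^{f(u|v)} · α₀^{f(u|v)}`
  have h0 := huB _ (hu0 v α₀ hv hα₀)
  rw [husplit v hv, Multiset.map_map] at h0
  rw [heq, Multiset.map_map]
  convert h0 using 2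
  simp only [Function.comp_apply, mul_pow]

end Summit.Langlands.Langlands.Theorems.IcosahedralDescentLevel

end
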